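import Mathlib
import HarnessLib

/-!
# Route `UnitScaleTilt`, crux K1 «MinimiserStabilityRegPr» (stmt-QuantumFields-19200) — route-R E′ (A′), LANE II «DIVERGENCE RECOVERY AT CURVED `W`» (★★OWNER RULING №23),
# brick (B13) «RESOLVENT-SMOOTHED PAIRING»: **a functional `f ↦ ⟪g, Δ f⟫` that is blind to `(1 − P)`-directions is bounded by `‖g‖·‖D f‖` with the SMOOTHED constant `4κ`,
# `κ := ‖D ∘ P‖`, NOT `‖D‖`** — generic finite-dimensional Hilbert-space lemma (no lattice); the device that removes every second covariant derivative (the «Laplacian row» of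
# the quasi-interpolant `J`) from the lane's assembly (★p1 g19 LANE II NAMER WORD №4, 2026-08-29).

Cell `ym3-torus` ∕ fleet seat `ym-ust-19200-p1` (gen 19, route-R E′ namer, LANE II namer).  THEOREMS ONLY (0 `def`, 0 `sorry`); `--supports stmt-QuantumFields-19200 --as helper`, count-neutral.
YM₃ on T³ is a ladder rung (R3), not d = 4, not the Clay problem; nothing here claims [Balaban1985BackgroundPropagators] Thm 3.11, `hN06`, the divergence-recovery row, E′, EX or the gap.

WHY.  In the divergence-recovery assembly (LOCATE #60 S3, px4 g7) the vector `g := (1 − R_W) D*_W y` is orthogonal to `Δ_W(ker Q′_W)` (`R_W` = the orthogonal projection onto that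
subspace, ✓`Prop7DivRecoveryForm`), so the functional `ℓ_g(μ) := ⟪g, Δ_W μ⟫` depends on `μ` only through `Q′_W μ`: `ℓ_g(μ) = ℓ_g(P μ)` for `P := J ∘ Q′_W`, `J` ANY right inverse of
`Q′_W`.  The naive bound `|ℓ_g(μ)| ≤ ‖g‖·‖Δ_W μ‖` needs a LAPLACIAN row for `J` — at a curved background that row costs a second covariant derivative of a transported object, which
`RegPr` does not control uniformly in `K` (NAMER WORD №2).  This file proves instead `|ℓ_g(μ)| ≤ 4κ·‖g‖·‖D μ‖` with `κ` the crude GRADIENT bound of `P` (`‖D(Pf)‖ ≤ κ‖f‖`; at the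
member `κ` is an absolute number — a bump gradient — while `‖D‖ ∼ η⁻¹` is K-dependent): write `μ = h + tΔh` with the resolvent `h = (1 + tΔ)⁻¹μ` (`‖Dh‖ ≤ ‖Dμ‖`, `√t‖Δh‖ ≤ ‖Dμ‖`,
elementary), `ℓ_g(μ) = ⟪g, Δh⟫ + t·ℓ_g(P(Δh))`, and close on the best constant `B` with `B ≤ t^{−1∕2}‖g‖ + √t·κ·B`, `√t := (2κ)⁻¹`.

WHAT IS PROVED (ns `…Theorems.Prop7ResolventSmoothedPairing`; `S, E` finite-dimensional complex inner-product spaces, `D : S →ₗ E`, `Δ := D† ∘ D`):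
* §1 `exists_resolvent` — `∀ t ≥ 0, ∀ x, ∃ h, x = h + t • Δ h`; ★ `norm_D_resolvent_le`, ★ `sqrt_mul_norm_laplace_resolvent_le` — the two resolvent bounds `‖Dh‖ ≤ ‖Dx‖`, `√t·‖Δh‖ ≤ ‖Dx‖`.
* §2 ★★★ `norm_inner_laplace_le_of_blind` — (B13): `(∀ f, ‖D (P f)‖ ≤ κ‖f‖)`, `0 < κ`, `(∀ f, ⟪g, Δ f⟫ = ⟪g, Δ (P f)⟫)` ⊢ `∀ x, ‖⟪g, Δ x⟫‖ ≤ 4κ·‖g‖·‖D x‖`.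
* §3 ★★ `norm_inner_laplace_le_of_orthogonal_ker` — the form the assembly reads: `Q′ : S →ₗ C`, `J : C →ₗ S`, `Q′ ∘ J = id`, `‖D(J(Q′ f))‖ ≤ κ‖f‖`, and `g ⊥ Δ(ker Q′)`
  (`∀ l, Q′ l = 0 → ⟪g, Δ l⟫ = 0`) ⊢ `‖⟪g, Δ x⟫‖ ≤ 4κ·‖g‖·‖D x‖` for every `x`.
HONEST SCOPE.  Finite-dimensional linear algebra; nothing of the lattice, of print, of (REC) ∕ `hN06` ∕ the crux is asserted; rung R3, not Clay; YM gap NOT proved.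

References: T. Bałaban, CMP 99 (1985) 389–434 [Balaban1985BackgroundPropagators] ((3.20)–(3.23) p.394, (3.26)–(3.27) p.395, Thm 3.11 p.416); [folklore] (resolvent identities for `D†D`).
-/

set_option autoImplicit false

noncomputable section

open scoped InnerProductSpace ComplexConjugate

namespace Summit.QuantumFields.YangMills.Theorems.Prop7ResolventSmoothedPairing

variable {S E : Type*} [NormedAddCommGroup S] [InnerProductSpace ℂ S] [FiniteDimensional ℂ S]
  [NormedAddCommGroup E] [InnerProductSpace ℂ E] [FiniteDimensional ℂ E]

/-! ## §1 The resolvent `(1 + tΔ)⁻¹` of `Δ = D†D` and its two bounds -/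

/-- `re⟪f, D†D f⟫ = ‖D f‖²`. [folklore] -/
theorem re_inner_adjoint_comp_self (D : S →ₗ[ℂ] E) (f : S) :
    RCLike.re ⟪f, LinearMap.adjoint D (D f)⟫_ℂ = ‖D f‖ ^ 2 := by
  rw [LinearMap.adjoint_inner_right, inner_self_eq_norm_sq_to_K]
  norm_cast

/-- `f ↦ f + t·D†D f` is injective for `t ≥ 0` (`re⟪f, f + tΔ f⟫ = ‖f‖² + t‖Df‖² ≥ ‖f‖²`). [folklore] -/
theorem injective_one_add_smul_laplace (D : S →ₗ[ℂ] E) {t : ℝ} (ht : 0 ≤ t) :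
    Function.Injective (LinearMap.id + ((t : ℝ) : ℂ) • (LinearMap.adjoint D ∘ₗ D) : S →ₗ[ℂ] S) := by
  set A : S →ₗ[ℂ] S := LinearMap.id + ((t : ℝ) : ℂ) • (LinearMap.adjoint D ∘ₗ D) with hAdef
  rw [← LinearMap.ker_eq_bot, LinearMap.ker_eq_bot']
  intro f hf
  have hAf : A f = f + ((t : ℝ) : ℂ) • LinearMap.adjoint D (D f) := by
    simp only [hAdef, LinearMap.add_apply, LinearMap.id_apply, LinearMap.smul_apply, LinearMap.comp_apply]
  have h0 : (⟪f, A f⟫_ℂ).re = 0 := by rw [hf, inner_zero_right, Complex.zero_re]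
  rw [hAf, inner_add_right, inner_smul_right, Complex.add_re, Complex.re_ofReal_mul] at h0
  have h1 : (⟪f, f⟫_ℂ).re = ‖f‖ ^ 2 := by
    have := inner_self_eq_norm_sq (𝕜 := ℂ) f
    simpa only [RCLike.re_to_complex] using this
  have h2 : (⟪f, LinearMap.adjoint D (D f)⟫_ℂ).re = ‖D f‖ ^ 2 := by
    have := re_inner_adjoint_comp_self D f
    simpa only [RCLike.re_to_complex] using this
  rw [h1, h2] at h0
  have h3 : ‖f‖ ^ 2 = 0 := by nlinarith [sq_nonneg ‖f‖, sq_nonneg ‖D f‖, mul_nonneg ht (sq_nonneg ‖D f‖)]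
  exact norm_eq_zero.mp (pow_eq_zero_iff two_ne_zero |>.mp h3)

/-- **THE RESOLVENT**: for `t ≥ 0` every `x` is `h + t·Δh` for some `h` (finite dimension: `1 + tΔ` injective ⟹ onto). [folklore] -/
theorem exists_resolvent (D : S →ₗ[ℂ] E) {t : ℝ} (ht : 0 ≤ t) (x : S) :
    ∃ h : S, x = h + ((t : ℝ) : ℂ) • LinearMap.adjoint D (D h) := by
  set A : S →ₗ[ℂ] S := LinearMap.id + ((t : ℝ) : ℂ) • (LinearMap.adjoint D ∘ₗ D) with hAdef
  have hinj : Function.Injective A := injective_one_add_smul_laplace D ht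
  obtain ⟨h, hh⟩ := (LinearMap.injective_iff_surjective.mp hinj) x
  refine ⟨h, ?_⟩
  rw [← hh]
  simp only [hAdef, LinearMap.add_apply, LinearMap.id_apply, LinearMap.smul_apply, LinearMap.comp_apply]

/-- The basic resolvent identity: if `x = h + tΔh` then `‖Dh‖² + t‖Δh‖² = re⟪Dh, Dx⟫ ≤ ‖Dh‖·‖Dx‖`. [folklore] -/
theorem resolvent_energy_le (D : S →ₗ[ℂ] E) {t : ℝ} (x h : S) (hx : x = h + ((t : ℝ) : ℂ) • LinearMap.adjoint D (D h)) :
    ‖D h‖ ^ 2 + t * ‖LinearMap.adjoint D (D h)‖ ^ 2 ≤ ‖D h‖ * ‖D x‖ := by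
  -- `⟪Δh, x⟫ = ⟪Δh, h⟫ + t‖Δh‖²` and `⟪Δh, x⟫ = ⟪Dh, Dx⟫`
  have hsplit : ⟪LinearMap.adjoint D (D h), x⟫_ℂ
      = ⟪LinearMap.adjoint D (D h), h⟫_ℂ + ((t : ℝ) : ℂ) * ⟪LinearMap.adjoint D (D h), LinearMap.adjoint D (D h)⟫_ℂ := by
    conv_lhs => rw [hx]
    rw [inner_add_right, inner_smul_right]
  have hre : RCLike.re ⟪LinearMap.adjoint D (D h), x⟫_ℂ = ‖D h‖ ^ 2 + t * ‖LinearMap.adjoint D (D h)‖ ^ 2 := by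
    have e1 : (⟪LinearMap.adjoint D (D h), h⟫_ℂ).re = ‖D h‖ ^ 2 := by
      rw [LinearMap.adjoint_inner_left]
      have := inner_self_eq_norm_sq (𝕜 := ℂ) (D h)
      simpa only [RCLike.re_to_complex] using this
    have e2 : (⟪LinearMap.adjoint D (D h), LinearMap.adjoint D (D h)⟫_ℂ).re = ‖LinearMap.adjoint D (D h)‖ ^ 2 := by
      have := inner_self_eq_norm_sq (𝕜 := ℂ) (LinearMap.adjoint D (D h))
      simpa only [RCLike.re_to_complex] using this
    rw [RCLike.re_to_complex, hsplit, Complex.add_re, Complex.re_ofReal_mul, e1, e2]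
  have hDD : ⟪LinearMap.adjoint D (D h), x⟫_ℂ = ⟪D h, D x⟫_ℂ := LinearMap.adjoint_inner_left _ _ _
  calc ‖D h‖ ^ 2 + t * ‖LinearMap.adjoint D (D h)‖ ^ 2 = RCLike.re ⟪D h, D x⟫_ℂ := by rw [← hDD, hre]
    _ ≤ ‖⟪D h, D x⟫_ℂ‖ := RCLike.re_le_norm _
    _ ≤ ‖D h‖ * ‖D x‖ := norm_inner_le_norm _ _

/-- ★ First resolvent bound: `‖D h‖ ≤ ‖D x‖` (`t ≥ 0`). [folklore] -/
theorem norm_D_resolvent_le (D : S →ₗ[ℂ] E) {t : ℝ} (ht : 0 ≤ t) (x h : S) (hx : x = h + ((t : ℝ) : ℂ) • LinearMap.adjoint D (D h)) :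
    ‖D h‖ ≤ ‖D x‖ := by
  have hE := resolvent_energy_le D x h hx
  have h1 : ‖D h‖ ^ 2 ≤ ‖D h‖ * ‖D x‖ := by nlinarith [mul_nonneg ht (sq_nonneg ‖LinearMap.adjoint D (D h)‖)]
  by_cases h0 : ‖D h‖ = 0
  · rw [h0]; exact norm_nonneg _
  · have hpos : 0 < ‖D h‖ := lt_of_le_of_ne (norm_nonneg _) (Ne.symm h0)
    nlinarith

/-- ★ Second resolvent bound: `√t·‖Δ h‖ ≤ ‖D x‖` (`t ≥ 0`). [folklore] -/
theorem sqrt_mul_norm_laplace_resolvent_le (D : S →ₗ[ℂ] E) {t : ℝ} (ht : 0 ≤ t) (x h : S) (hx : x = h + ((t : ℝ) : ℂ) • LinearMap.adjoint D (D h)) :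
    Real.sqrt t * ‖LinearMap.adjoint D (D h)‖ ≤ ‖D x‖ := by
  have hE := resolvent_energy_le D x h hx
  have hDh := norm_D_resolvent_le D ht x h hx
  have h1 : t * ‖LinearMap.adjoint D (D h)‖ ^ 2 ≤ ‖D x‖ ^ 2 := by
    nlinarith [sq_nonneg ‖D h‖, norm_nonneg (D h), norm_nonneg (D x), mul_le_mul_of_nonneg_right hDh (norm_nonneg (D x))]
  have h2 := Real.sqrt_le_sqrt h1
  rw [Real.sqrt_mul ht, Real.sqrt_sq (norm_nonneg _), Real.sqrt_sq (norm_nonneg _)] at h2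
  exact h2

/-! ## §2 ★★★ (B13) The smoothed bound for a `(1 − P)`-blind functional -/

/-- ★★★ **(B13) RESOLVENT-SMOOTHED PAIRING.**  `D : S → E` linear, `Δ := D†D`; `P : S → S` linear with the CRUDE GRADIENT ROW `‖D(Pf)‖ ≤ κ‖f‖` (`κ > 0`); `g ∈ S` such that the
functional `f ↦ ⟪g, Δ f⟫` is BLIND to `(1 − P)`: `⟪g, Δ f⟫ = ⟪g, Δ(P f)⟫` for all `f`.  Then for EVERY `x`:  `‖⟪g, Δ x⟫‖ ≤ 4κ·‖g‖·‖D x‖` — first order in `x`, zeroth order in `g`,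
with the smoothed constant `κ` in place of `‖D‖`.  (At the member: `g = (1 − R_W)D*_W y`, `P = J ∘ Q′_W`, `κ` an absolute bump-gradient number, while `‖D_W‖ ∼ η⁻¹`.)
[folklore; cite: Balaban1985BackgroundPropagators, (3.20)-(3.23) p.394] -/
theorem norm_inner_laplace_le_of_blind (D : S →ₗ[ℂ] E) (P : S →ₗ[ℂ] S) {κ : ℝ} (hκ : 0 < κ)
    (hP : ∀ f : S, ‖D (P f)‖ ≤ κ * ‖f‖) (g : S)
    (hg : ∀ f : S, ⟪g, LinearMap.adjoint D (D f)⟫_ℂ = ⟪g, LinearMap.adjoint D (D (P f))⟫_ℂ) (x : S) :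
    ‖⟪g, LinearMap.adjoint D (D x)⟫_ℂ‖ ≤ 4 * κ * ‖g‖ * ‖D x‖ := by
  -- the set of admissible constants and its infimum
  set A : Set ℝ := {b : ℝ | 0 ≤ b ∧ ∀ f : S, ‖⟪g, LinearMap.adjoint D (D f)⟫_ℂ‖ ≤ b * ‖D f‖} with hA
  have hmem : ‖D g‖ ∈ A := by
    refine ⟨norm_nonneg _, fun f => ?_⟩
    rw [LinearMap.adjoint_inner_right]
    exact norm_inner_le_norm _ _
  have hne : A.Nonempty := ⟨_, hmem⟩
  have hbdd : BddBelow A := ⟨0, fun b hb => hb.1⟩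
  set B : ℝ := sInf A with hB
  have hB0 : 0 ≤ B := le_csInf hne fun b hb => hb.1
  -- `B` itself is admissible
  have hBadm : ∀ f : S, ‖⟪g, LinearMap.adjoint D (D f)⟫_ℂ‖ ≤ B * ‖D f‖ := by
    intro f
    by_cases hf : ‖D f‖ = 0
    · have := hmem.2 f
      rw [hf, mul_zero] at this ⊢
      exact this
    · have hfpos : 0 < ‖D f‖ := lt_of_le_of_ne (norm_nonneg _) (Ne.symm hf)
      have key : ‖⟪g, LinearMap.adjoint D (D f)⟫_ℂ‖ / ‖D f‖ ≤ B :=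
        le_csInf hne fun b hb => (div_le_iff₀ hfpos).mpr (hb.2 f)
      exact (div_le_iff₀ hfpos).mp key
  -- the resolvent step: `B' := t^{-1/2}‖g‖ + √t κ B` is admissible, with `√t = (2κ)⁻¹`
  set s : ℝ := (2 * κ)⁻¹ with hs
  have hspos : 0 < s := by rw [hs]; positivity
  set t : ℝ := s ^ 2 with ht
  have htpos : 0 < t := by rw [ht]; positivity
  have hsqrt : Real.sqrt t = s := by rw [ht, Real.sqrt_sq hspos.le]
  have hstep : ∀ f : S, ‖⟪g, LinearMap.adjoint D (D f)⟫_ℂ‖ ≤ (s⁻¹ * ‖g‖ + s * κ * B) * ‖D f‖ := by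
    intro f
    obtain ⟨h, hfh⟩ := exists_resolvent D htpos.le f
    have hDh := norm_D_resolvent_le D htpos.le f h hfh
    have hΔh := sqrt_mul_norm_laplace_resolvent_le D htpos.le f h hfh
    rw [hsqrt] at hΔh
    -- `⟪g, Δ f⟫ = ⟪g, Δ h⟫ + t·⟪g, Δ(Δ h)⟫ = ⟪g, Δ h⟫ + t·⟪g, Δ(P (Δ h))⟫`
    have hlin : ⟪g, LinearMap.adjoint D (D f)⟫_ℂ
        = ⟪g, LinearMap.adjoint D (D h)⟫_ℂ + ((t : ℝ) : ℂ) * ⟪g, LinearMap.adjoint D (D (P (LinearMap.adjoint D (D h))))⟫_ℂ := by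
      conv_lhs => rw [hfh]
      rw [map_add, map_add, map_smul, map_smul, inner_add_right, inner_smul_right, ← hg]
    have hnorm_le : ‖LinearMap.adjoint D (D h)‖ ≤ s⁻¹ * ‖D f‖ := by
      rw [le_inv_mul_iff₀' hspos]; linarith [hΔh, mul_comm s ‖LinearMap.adjoint D (D h)‖]
    have hA1 : ‖⟪g, LinearMap.adjoint D (D h)⟫_ℂ‖ ≤ ‖g‖ * (s⁻¹ * ‖D f‖) :=
      (norm_inner_le_norm _ _).trans (mul_le_mul_of_nonneg_left hnorm_le (norm_nonneg _))
    have hA2 : ‖((t : ℝ) : ℂ) * ⟪g, LinearMap.adjoint D (D (P (LinearMap.adjoint D (D h))))⟫_ℂ‖ ≤ t * (B * (κ * (s⁻¹ * ‖D f‖))) := by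
      rw [norm_mul, Complex.norm_real, Real.norm_of_nonneg htpos.le]
      refine mul_le_mul_of_nonneg_left ?_ htpos.le
      calc ‖⟪g, LinearMap.adjoint D (D (P (LinearMap.adjoint D (D h))))⟫_ℂ‖ ≤ B * ‖D (P (LinearMap.adjoint D (D h)))‖ := hBadm _
        _ ≤ B * (κ * ‖LinearMap.adjoint D (D h)‖) := mul_le_mul_of_nonneg_left (hP _) hB0
        _ ≤ B * (κ * (s⁻¹ * ‖D f‖)) := mul_le_mul_of_nonneg_left (mul_le_mul_of_nonneg_left hnorm_le hκ.le) hB0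
    calc ‖⟪g, LinearMap.adjoint D (D f)⟫_ℂ‖
        ≤ ‖⟪g, LinearMap.adjoint D (D h)⟫_ℂ‖ + ‖((t : ℝ) : ℂ) * ⟪g, LinearMap.adjoint D (D (P (LinearMap.adjoint D (D h))))⟫_ℂ‖ := by
          rw [hlin]; exact norm_add_le _ _
      _ ≤ ‖g‖ * (s⁻¹ * ‖D f‖) + t * (B * (κ * (s⁻¹ * ‖D f‖))) := add_le_add hA1 hA2
      _ = (s⁻¹ * ‖g‖ + s * κ * B) * ‖D f‖ := by rw [ht]; field_simp
  have hadm' : s⁻¹ * ‖g‖ + s * κ * B ∈ A := ⟨by positivity, hstep⟩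
  have hBle : B ≤ s⁻¹ * ‖g‖ + s * κ * B := csInf_le hbdd hadm'
  -- `s κ = 1/2`, so `B ≤ 2·s⁻¹‖g‖ = 4κ‖g‖`
  have hsk : s * κ = 1 / 2 := by rw [hs]; field_simp
  have hsinv : s⁻¹ = 2 * κ := by rw [hs, inv_inv]
  rw [hsk, hsinv] at hBle
  have hBfin : B ≤ 4 * κ * ‖g‖ := by linarith
  calc ‖⟪g, LinearMap.adjoint D (D x)⟫_ℂ‖ ≤ B * ‖D x‖ := hBadm x
    _ ≤ 4 * κ * ‖g‖ * ‖D x‖ := mul_le_mul_of_nonneg_right hBfin (norm_nonneg _)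

/-! ## §3 ★★ The form the assembly reads: `g ⊥ Δ(ker Q′)`, `P := J ∘ Q′` -/

/-- ★★ **(B13) AT A RIGHT INVERSE.**  `Q′ : S → C` linear, `J : C → S` linear with `Q′ (J u) = u`; the composite `J ∘ Q′` has the crude gradient row `‖D(J(Q′ f))‖ ≤ κ‖f‖` (`κ > 0`);
`g` is orthogonal to `Δ(ker Q′)` in the sense `Q′ l = 0 → ⟪g, Δ l⟫ = 0` (at the member: `g = (1 − RcombL2 W)(DstarL2 W y)`, ✓`Prop7DivRecoveryForm.inner_eq_inner_projR_of_ker`).  Then for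
every `x`: `‖⟪g, Δ x⟫‖ ≤ 4κ·‖g‖·‖D x‖`.  In particular `⟪g, Δ(J w)⟫` — the only place LOCATE #60 S3 applied `Δ_W` to `J w` — is bounded by the GRADIENT row of `J` alone.
[folklore; cite: Balaban1985BackgroundPropagators, (3.20)-(3.23) p.394, (3.19) p.393] -/
theorem norm_inner_laplace_le_of_orthogonal_ker {C : Type*} [AddCommGroup C] [Module ℂ C]
    (D : S →ₗ[ℂ] E) (Q' : S →ₗ[ℂ] C) (J : C →ₗ[ℂ] S) (hQJ : ∀ u : C, Q' (J u) = u) {κ : ℝ} (hκ : 0 < κ)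
    (hJ : ∀ f : S, ‖D (J (Q' f))‖ ≤ κ * ‖f‖) (g : S)
    (hg : ∀ l : S, Q' l = 0 → ⟪g, LinearMap.adjoint D (D l)⟫_ℂ = 0) (x : S) :
    ‖⟪g, LinearMap.adjoint D (D x)⟫_ℂ‖ ≤ 4 * κ * ‖g‖ * ‖D x‖ := by
  refine norm_inner_laplace_le_of_blind D (J ∘ₗ Q') hκ (fun f => hJ f) g (fun f => ?_) x
  -- `f − J(Q′ f) ∈ ker Q′`, so `g` is blind to it
  have hker : Q' (f - J (Q' f)) = 0 := by rw [map_sub, hQJ, sub_self]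
  have h0 := hg _ hker
  rw [map_sub, map_sub, inner_sub_right, sub_eq_zero] at h0
  rw [LinearMap.comp_apply]
  exact h0

end Summit.QuantumFields.YangMills.Theorems.Prop7ResolventSmoothedPairing

end
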